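import Mathlib
import Summits.PneNP.PneNP.Theorems.Nc03AvoidResidualCoreCandStarReductionDefs
import Summits.PneNP.PneNP.Theorems.Nc03AvoidResidualCoreCandStarReductionExists
import Summits.PneNP.PneNP.Theorems.Nc03AvoidResidualCoreCandStarReductionFP
import Summits.PneNP.PneNP.Theorems.Nc03AvoidResidualCoreCandStarSplit
import Literature.Computability.Complexity.CodeFPStrings
import Literature.Computability.Complexity.CookBridges

/-!
# Route Nc03AvoidResidualCore, item `CandStarReduction` (★) — registered stub `stub_cherryStar`

Stub file for `stmt-PneNP-19963` (cell pnp-ideate; birth skeleton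
Cruxes/CandStarReduction/Lines/birth.lean, tribunal-w g6): **`stub_cherryStar : TangledSurplusFP`** —
ONE polynomial-time string function which, on the input code of every pure-`CAND` instance with
`0 < n` and at least `n + 1` tangled outputs, prints a point outside its range (cell memo
pnp-ideate-p2/ROUND-3-ADDENDUM-B, Thm B.1 ★, in the root-free form of `…CandStarReductionProgram`).

Assembly: parse the input code (`Nc03Reduction.codeFP_toRaw`, landed with stmt-PneNP-20227), strip
the table bytes to the raw pure form (`Nc03CandStar.prOfRI`, `prOfRI_toRaw`, `codeFP_prOfRI` — landed
in `…CandStarSplit`, prover-2 g8, imported not restated), run the ★-solver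
(`Nc03CandStarRF.codeFP_solStar`), emit the bits (`CodeFP.bitsToStr`); ONE `CodeFP`
program `eIn → strE`, hence ONE `IsPolyTime` function (`CookBridges.isPolyTime_iff`) — quantified
OUTSIDE `∀ n m I`; correctness is `Nc03CandStarRF.solStar_correct`. The statement `TangledSurplusFP` is
the landed skeleton object (`…CandStarReductionDefs`, p505075), imported, not restated.

Restricted-model (NC⁰₃) range-avoidance rung F-N1b of the PneNP frontier ladder (an algorithmic
reduction between two restricted AVOID problems); nothing here bears on P vs NP.
-/

set_option linter.dupNamespace false -- `Summit.PneNP.PneNP.…`: summit = sub-problem name (D-0017 single-conjunct layout)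

namespace Summit.PneNP.PneNP.Theorems.Nc03CandStar

open Finset Literature.Computability.Complexity CodeFP
open Summit.PneNP.PneNP.Theorems.Nc03Reduction (eIn toRaw rawOf codeFP_toRaw)
open Summit.PneNP.PneNP.Theorems.Nc03CandStarRF (solStar codeFP_solStar solStar_correct)
open Summit.PneNP.PneNP.Theorems.Nc03AvoidResidualCoreCandCherry (tangled)

/-- **The ★-solver from input codes to output strings is ONE polynomial-time program.** -/
theorem codeFP_starSolver : CodeFP eIn strE (fun x => solStar (prOfRI (toRaw x))) :=
  (bitsToStr.comp (codeFP_solStar.comp (codeFP_prOfRI.comp codeFP_toRaw))).congr fun _ => rfl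

/-- **Registered stub `stub_cherryStar` of the birth skeleton of `CandStarReduction`** (Thm B.1 ★,
first sentence, root-free form): ONE polynomial-time avoider for every pure-`CAND` instance with at
least `n + 1` tangled outputs. -/
theorem stub_cherryStar : TangledSurplusFP := by
  obtain ⟨F, hF, hFspec⟩ := codeFP_starSolver
  refine ⟨F, (CookBridges.isPolyTime_iff F).2 hF, fun n m I hP hn hT => ?_⟩
  have e : readOut m (F I.encode) = fun j : Fin m => (solStar (rawOf I)).getD j.val false := by
    funext j
    unfold readOut
    rw [show I.encode = eIn ⟨n, m, I⟩ from rfl, hFspec]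
    show (solStar (prOfRI (toRaw ⟨n, m, I⟩))).getD j.val false = _
    rw [prOfRI_toRaw]
  rw [e]
  exact solStar_correct I hP hn hT

end Summit.PneNP.PneNP.Theorems.Nc03CandStar
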